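import Summits.BirchSwinnertonDyer.Rank1Residual.Additive.XGordRankZeroCyclotomicPrimePrep
import Summits.BirchSwinnertonDyer.Rank1Residual.Additive.CyclotomicZpExtensionPrime
import Summits.BirchSwinnertonDyer.Rank1Residual.Additive.SelmerControlFiniteness
import Summits.BirchSwinnertonDyer.Rank1Residual.Additive.CyclotomicPrimeShaRestriction
import HarnessLib

/-!
# X3/X4 at a potentially good ordinary odd `p` with `e = 2`, ranks `(0,0)`, over `F = ℚ(ζ_p)`, ALL
# `p − 1` branches (line V19): `ord_p#Ш(V) + ord_p#Ш(W) ≤ ord_p#Ш_an(V) + ord_p#Ш_an(W) + explicit terms`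

HONEST FRAMING (cell `b2b-bsdres`, run/shared/lean/b2b/bsd-rank1-residual/, verbatim in every
file): the goal of the cell is to DELETE the COMBINATION-SHAPED residual classes of the
Birch–Swinnerton-Dyer formula for ALL analytic-rank `≤ 1` elliptic curves over `ℚ` — "full BSD
formula for every rank `≤ 1` curve in class `C`" assembled STRICTLY from published theorems — so
that the rank-`≤ 1` remainder becomes exactly the CONSTRUCTION-SHAPED classes, which are TYPED
(missing-input `Prop`s), NOT attempted. This is not "finishing BSD". Seat additive-p4 (research route
on X3/X4); the labels of X3 and X4 are UNCHANGED by this file; nothing is booked here.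

Theorems only (no `def`, no `sorry`, no new named fact). Lines V14–V18 removed the unprinted
descent `X(W/ℚ_∞) ≅ X(V/ℚ(μ_{p^∞}))^{(χ)}` at `p = 3` by working over `K = ℚ(ζ₃)`; line V19 does the
same at EVERY odd `p`, over `F = ℚ(ζ_p)` (`F_∞ = ℚ(μ_{p^∞})` literally). Inputs: the divisibility
`char_Λ X(V/F_∞) ∋ u·ϖ^{m}ϖ'^{m}·∏_{i<p−1} L_p(V,ω^i,T)`, `m = (p−1)/2` (named facts
`Wuthrich2014.charIdeal_dvd_padicLFunction_cyclotomicPrime` (X3) /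
`Kato2004.charIdeal_dvd_padicLFunction_cyclotomicPrime_of_surjective` (X4), INLINE here as `hDivF`);
Greenberg LNM 1716 Thm. 4.1 for `V_F` (inline `hGrF`, the `F`-shape of the fact
`thm41_charValue_rankZero_numberField` at the unique prime over `p`, `k_𝔭 = 𝔽_p`), its hypothesis
"`Sel_{p^∞}(V/F)` finite" coming from the divisibility itself (`g(0) ≠ 0 ⇒ f_E(0) ≠ 0 ⇒` control,
`SelmerControlFiniteness`); at `T = 0`: `L_p(V,ω⁰,0) = (1−α⁻¹)²[0]⁺_f`, the MIDDLE branch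
`L_p(V,ω^{m},0) = α⁻¹∑(a/p)[a/p]^±_f` matched with `L(W,1)/Ω_W` by Birch + Pal (tree, both parities,
`ord_p u(C) = 0`), the anomalous factor cancelling against Greenberg's `#Ẽ_𝔭(k_𝔭)[p^∞]²`; the descent
`ℚ → F`: `ord_p#Ш(V) + ord_p#Ш(W) ≤ ord_p #Sel_{p^∞}(V/F)` (`CyclotomicPrimeShaRestriction`). What
does NOT cancel over `F` is carried as EXPLICIT per-pair terms: the other branch values
`o = ∏_{i ∉ {0,m}} L_p(V,ω^i,0)` (algebraic parts of the twisted values `L(V,ω^{−i},1)`, computable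
from modular symbols), `ord_p ∏_w c_w(V_F)`, `ord_p #V(F)`, and the period exponents of the `p − 3`
unmatched branches. The cyclotomic setting over `F` is the tree theorem
`exists_isCyclotomic_isTopGenerator_cyclotomicPrime`. Facts-only corollaries and the census:
`XGordRankZeroCyclotomicPrimeFacts.lean`.
-/

noncomputable section

open scoped Classical MatrixGroups ModularForm

open CongruenceSubgroup WeierstrassCurve NumberField IsDedekindDomain
  Literature.NumberTheory.EllipticCurves Literature.NumberTheory.EllipticCurves.ModularForms
  Literature.NumberTheory.EllipticCurves.Rank1Residual
  Literature.NumberTheory.EllipticCurves.Rank1Residual.Typed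
  Literature.NumberTheory.GaloisRepresentations

namespace Summit.BirchSwinnertonDyer.Rank1Residual.Additive

section Core

variable (p : ℕ) [hp : Fact p.Prime] (F : Type) [Field F] [NumberField F] [IsCyclotomicExtension {p} ℚ F]
  (V : WeierstrassCurve ℚ) [V.IsElliptic] [V.IsGloballyMinimal]
  (W : WeierstrassCurve ℚ) [W.IsElliptic] [W.IsGloballyMinimal]

/-- **Core theorem (line V19, odd `p`, rank `0 + 0`, all branches over `F = ℚ(ζ_p)`).** Let `V/ℚ`
be globally minimal, good ORDINARY at the odd prime `p`, and `W = C • V^{(p*)}`,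
`p* = (−1)^{(p−1)/2}p`, a globally minimal model of its twist, ADDITIVE at `p` (the X3 / X4 situation
with `e = 2`: Kodaira type `I₀*`), both of analytic rank `0`; `f` the newform of `V`, `ϖ·Ω_V = Ω⁺_f`,
`ϖ'·|Ω⁻(V)| = Ω⁻_f`, `α = unitRoot V p`, `B_i = L_p(f,α,ω^i,T)` (`padicLFunctionBranch` for even `i`,
`padicLFunctionMinusBranch` for odd `i`). ASSUME, over `F`:
* `hDivF` — **Wuthrich 2014 Thm. 16 / Kato 2004 Thm. 17.4 (3) read over `F`** (the named facts
  `charIdeal_dvd_padicLFunction_cyclotomicPrime[_of_surjective]` specialised to `V`, `F`, `V ⊗ F`):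
  `X(V/F_∞)` is `Λ`-torsion and `u ϖ^{m}ϖ'^{m}·∏_{i<p−1} B_i = ι g`, `g ∈ char_Λ X(V/F_∞)`, `m = (p−1)/2`;
* `hGrF` — **Greenberg, LNM 1716, Thm. 4.1 for `E = V_F` over `F`** (inline, the `F`-shape of the
  fact `thm41_charValue_rankZero_numberField` at the unique prime `𝔭` of `F` above `p`,
  `k_𝔭 = 𝔽_p`): if `Sel_{p^∞}(V_F/F)` is finite and `f_E` generates `char_Λ X(V/F_∞)` then
  `f_E(0)·#V(F)[p^∞]² ∼ p^{ord_p ∏_w c_w(V_F)} · #Ṽ(𝔽_p)[p^∞]² · #Sel_{p^∞}(V_F/F)`;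
* `hO` — the other branch constant terms are non-zero: `o = ∏_{i ∉ {0, (p−1)/2}} B_i(0) ≠ 0`.
THEN, with Gross–Zagier–Kolyvagin (`hGZK`) and modularity (`hmod`): `#Ш_an(V) = q_V`,
`#Ш_an(W) = q_W` are rationals with
**`ord_p #Ш(V) + ord_p #Ш(W) + ord_p ∏_w c_w(V_F) + 2(ord_p #V(ℚ) + ord_p #W(ℚ)) ≤ ord_p q_V + ord_p q_W
+ ord_p ∏c(V) + ord_p ∏c(W) + 2 ord_p #V(F) + v(o) + m(ord_p ϖ + ord_p ϖ') − ord_p ϖ − ord_p ϖ_mid`**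
(`ϖ_mid = ϖ` if `p ≡ 1 (mod 4)`, `ϖ'` if `p ≡ 3 (mod 4)`). Proof: module docstring.
[cite: Wuthrich2014, Thm. 16 (p. 397)] [cite: Kato2004Asterisque, Thm. 17.4 (3) (p. 273)]
[cite: GreenbergLNM1716, Thm. 4.1 (p. 102), Lemma 4.2 (p. 103), Lemma 3.1 (p. 86)]
[cite: MazurTateTeitelbaum1986Invent, §I.13–I.14] [cite: DokchitserDokchitserAnnals2010, Lemma 4.14 (proof)] -/
theorem XGordCyclotomicPrime.exists_padicVal_shaOrder_add_le
    (hGZK : rank_eq_analyticRank_of_analyticRank_le_one) (hmod : hasEntireLFunction_rat)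
    (hp2 : p ≠ 2) (C : VariableChange ℚ) (hC : C • V.quadraticTwist ((-1 : ℚ) ^ (p / 2) * p) = W)
    (hord : IsOrdinaryAt V p) (hadd : Addv W p)
    (hrV : V.analyticRank = 0) (hrW : W.analyticRank = 0)
    {N : ℕ} [NeZero N] {f : CuspForm (Gamma0 N) 2} (hf : IsNewformOf V f)
    (ϖ ϖ' : ℚ) (hϖ : (ϖ : ℝ) * V.realPeriodRat = plusPeriod f)
    (hϖ' : (ϖ' : ℝ) * V.imaginaryPeriodRat = minusPeriod f)
    (hDivF : ∀ (κ : ZpExtension F p) (γ : Field.absoluteGaloisGroup F),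
      κ.IsCyclotomic → κ.IsTopGenerator γ →
      (∃ ζ : ℤ_[p]ˣ, IsOfFinOrder ζ ∧
        ((GaloisRep.cyclotomicCharacter F p γ * ζ : ℤ_[p]ˣ) : ℤ_[p]) = (cyclotomicGenerator p : ℤ_[p])) →
      ∀ D : (V.baseChange F).SelmerDualData κ γ,
        D.IsTorsion ∧ ∃ g ∈ D.charIdeal, ∃ u : ℤ_[p]ˣ,
          iwasawaToPowerSeries p g =
            PowerSeries.C (((u : ℤ_[p]) : ℚ_[p]) * (ϖ : ℚ_[p]) ^ (p / 2) * (ϖ' : ℚ_[p]) ^ (p / 2)) *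
              ∏ i ∈ Finset.range (p - 1),
                (if Even i then padicLFunctionBranch f ((unitRoot V p : ℤ_[p]) : ℚ_[p]) i
                  else padicLFunctionMinusBranch f ((unitRoot V p : ℤ_[p]) : ℚ_[p]) i))
    (hGrF : ∀ (κ : ZpExtension F p) (γ : Field.absoluteGaloisGroup F),
        κ.IsCyclotomic → κ.IsTopGenerator γ →
      ∀ (D : (V.baseChange F).SelmerDualData κ γ) [Module.Finite (IwasawaAlgebra p) D.X], D.IsTorsion →
      ∀ (fE : IwasawaAlgebra p), D.charIdeal = Ideal.span {fE} →
        Finite ((V.baseChange F).selmerGroupPInfty p) →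
        ∃ u : ℤ_[p]ˣ,
          ((PowerSeries.constantCoeff fE : ℤ_[p]) : ℚ_[p]) *
              (Nat.card (AddCommGroup.primaryComponent (V.baseChange F).toAffine.Point p) : ℚ_[p]) ^ 2 =
            ((u : ℤ_[p]) : ℚ_[p]) * (p : ℚ_[p]) ^ (padicValNat p (V.baseChange F).tamagawaProduct) *
              (Nat.card (AddCommGroup.primaryComponent
                ((integralModelInt V).map (Int.castRingHom (ZMod p))).toAffine.Point p) : ℚ_[p]) ^ 2 *
              (Nat.card ((V.baseChange F).selmerGroupPInfty p) : ℚ_[p]))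
    (hO : (∏ i ∈ ((Finset.range (p - 1)).erase 0).erase (p / 2),
        PowerSeries.constantCoeff
          (if Even i then padicLFunctionBranch f ((unitRoot V p : ℤ_[p]) : ℚ_[p]) i
            else padicLFunctionMinusBranch f ((unitRoot V p : ℤ_[p]) : ℚ_[p]) i)) ≠ 0) :
    ∃ qV qW : ℚ, shaAn V = (qV : ℂ) ∧ shaAn W = (qW : ℂ) ∧
      (padicValNat p V.shaOrder : ℤ) + padicValNat p W.shaOrder +
            padicValNat p (V.baseChange F).tamagawaProduct +
            2 * (padicValNat p (Nat.card V.toAffine.Point) + padicValNat p (Nat.card W.toAffine.Point)) ≤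
        padicValRat p qV + padicValRat p qW +
          padicValNat p V.tamagawaProduct + padicValNat p W.tamagawaProduct +
          2 * padicValNat p (Nat.card (V.baseChange F).toAffine.Point) +
          (∏ i ∈ ((Finset.range (p - 1)).erase 0).erase (p / 2),
              PowerSeries.constantCoeff
                (if Even i then padicLFunctionBranch f ((unitRoot V p : ℤ_[p]) : ℚ_[p]) i
                  else padicLFunctionMinusBranch f ((unitRoot V p : ℤ_[p]) : ℚ_[p]) i)).valuation +
          ((p / 2 : ℕ) : ℤ) * (padicValRat p ϖ + padicValRat p ϖ') - padicValRat p ϖ -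
          (if p % 4 = 1 then padicValRat p ϖ else padicValRat p ϖ') := by
  classical
  haveI : NeZero p := ⟨hp.out.ne_zero⟩
  have hp3 : 3 ≤ p := by
    have h2 := hp.out.two_le
    omega
  have hodd : p % 4 = 1 ∨ p % 4 = 3 := by
    obtain ⟨k, hk⟩ := hp.out.odd_of_ne_two hp2
    omega
  haveI : (V.baseChange F).IsElliptic := by rw [baseChange]; infer_instance
  -- names for the analytic objects
  set a : ℚ_[p] := ((unitRoot V p : ℤ_[p]) : ℚ_[p]) with ha
  set B : ℕ → PowerSeries ℚ_[p] := fun i ↦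
    (if Even i then padicLFunctionBranch f a i else padicLFunctionMinusBranch f a i) with hB
  set o : ℚ_[p] := ∏ i ∈ ((Finset.range (p - 1)).erase 0).erase (p / 2),
    PowerSeries.constantCoeff (B i) with ho
  -- rank 0: `L(·,1) ≠ 0`, Mordell–Weil groups and `Ш` finite
  have hLV : V.entireLFunction 1 ≠ 0 := (V.analyticRank_eq_zero_iff_holds (hmod V)).mp hrV
  have hLW : W.entireLFunction 1 ≠ 0 := (W.analyticRank_eq_zero_iff_holds (hmod W)).mp hrW
  obtain ⟨hmwV, hfinV⟩ := hGZK V (by rw [hrV]; exact zero_le_one)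
  obtain ⟨hmwW, hfinW⟩ := hGZK W (by rw [hrW]; exact zero_le_one)
  haveI : Finite V.sha := hfinV
  haveI : Finite W.sha := hfinW
  haveI hEV : Finite V.toAffine.Point := V.finite_point_of_rank_zero (by rw [hmwV, hrV])
  haveI hEW : Finite W.toAffine.Point := W.finite_point_of_rank_zero (by rw [hmwW, hrW])
  set VF := V.baseChange F with hVF
  -- the cyclotomic setting over `F`, the Iwasawa module `X(V/F_∞)`
  obtain ⟨κ, hκ, γ, hγ, hγ'⟩ := exists_isCyclotomic_isTopGenerator_cyclotomicPrime p F
  obtain ⟨D⟩ := VF.nonempty_selmerDualData_holds κ γ hγ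
  haveI : Module.Finite (IwasawaAlgebra p) D.X :=
    (SelmerDualData.module_finite_of_isCyclotomic (W := VF) (κ := κ) hκ D) hγ
  -- the divisibility over `F`
  obtain ⟨hX, g, hgmem, u, hιg⟩ := hDivF κ γ hκ hγ hγ' D
  haveI : (Module.charIdeal (IwasawaAlgebra p) D.X).IsPrincipal := charIdeal_isPrincipal_holds p D.X
  obtain ⟨fE, hchar⟩ := Submodule.IsPrincipal.principal (Module.charIdeal (IwasawaAlgebra p) D.X)
  have hchar' : D.charIdeal = Ideal.span {fE} := hchar
  have hgmem' : g ∈ Ideal.span {fE} := by rw [← hchar']; exact hgmem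
  obtain ⟨h, hgh⟩ := Ideal.mem_span_singleton'.mp hgmem'
  -- the analytic side over `ℚ` for `V`: `t_V = ϖ [0]⁺_f = L(V,1)/Ω_V`
  set sV : ℚ := ratPlusSymbol f 0 with hsV
  set tV : ℚ := ϖ * sV with htV
  have hΩV : (V.realPeriodRat : ℂ) ≠ 0 := by exact_mod_cast V.realPeriodRat_pos_holds.ne'
  have hLvalV : V.entireLFunction 1 = (((sV : ℝ) * plusPeriod f : ℝ) : ℂ) := hf.entireLFunction_one_eq
  have hqV' : V.entireLFunction 1 / (V.realPeriodRat : ℂ) = ((tV : ℚ) : ℂ) := by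
    rw [hLvalV, ← hϖ, div_eq_iff hΩV, htV]
    push_cast
    ring
  have htV0 : tV ≠ 0 := by
    intro h0
    apply hLV
    have := (div_eq_iff hΩV).mp hqV'
    rw [this, h0]
    simp
  have hϖ0 : ϖ ≠ 0 := fun h0 ↦ htV0 (by rw [htV, h0, zero_mul])
  have hsV0 : sV ≠ 0 := fun h0 ↦ htV0 (by rw [htV, h0, mul_zero])
  obtain ⟨-, -, -, hshaV⟩ := Wuthrich2014.shaAn_eq_of_L_one_div_eq hGZK V hLV hqV'
  -- `ord_p u(C) = 0`, the analytic side over `ℚ` for `W` and the middle branch (both parities)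
  have hΩW : (W.realPeriodRat : ℂ) ≠ 0 := by exact_mod_cast W.realPeriodRat_pos_holds.ne'
  obtain ⟨ϖm, S, tW, hBmid, hqW', htW0, hS0, hvtW, hvϖm⟩ :=
    XGordCyclotomicPrime.exists_midBranch_datum p V W hmod hp2 C hC hord hadd hf ϖ ϖ' hϖ hϖ' hϖ0 hLW
  have hBmid' : PowerSeries.constantCoeff (B (p / 2)) = a⁻¹ * ((S : ℚ) : ℚ_[p]) := hBmid
  obtain ⟨-, -, -, hshaW⟩ := Wuthrich2014.shaAn_eq_of_L_one_div_eq hGZK W hLW hqW'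
  -- `ϖ' ≠ 0` (`Ω⁻_f > 0`)
  have hϖ'0 : ϖ' ≠ 0 := by
    intro h0
    have hpos : 0 < minusPeriod f := IsNewform0.minusPeriod_pos_holds hf.1 hf.coeffField_eq_bot
    rw [h0, Rat.cast_zero, zero_mul] at hϖ'
    exact hpos.ne' hϖ'.symm
  -- the product over the branches: `∏ B_i = B_0 · (B_mid · O)`
  have h0mem : (0 : ℕ) ∈ Finset.range (p - 1) := Finset.mem_range.mpr (by omega)
  have hmidmem : p / 2 ∈ (Finset.range (p - 1)).erase 0 := by
    rw [Finset.mem_erase, Finset.mem_range]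
    constructor <;> omega
  have hprod : ∏ i ∈ Finset.range (p - 1), B i =
      B 0 * (B (p / 2) * ∏ i ∈ ((Finset.range (p - 1)).erase 0).erase (p / 2), B i) := by
    rw [Finset.mul_prod_erase _ _ hmidmem, Finset.mul_prod_erase _ _ h0mem]
  have hB0 : B 0 = padicLFunction f a := by
    have h : B 0 = padicLFunctionBranch f a 0 := by simp only [hB, Even.zero, if_true]
    rw [h]
    exact padicLFunctionBranch_zero f a
  have hιg' : iwasawaToPowerSeries p g =
      PowerSeries.C (((u : ℤ_[p]) : ℚ_[p]) * (ϖ : ℚ_[p]) ^ (p / 2) * (ϖ' : ℚ_[p]) ^ (p / 2)) *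
        ∏ i ∈ Finset.range (p - 1), B i := hιg
  have hO' : o ≠ 0 := hO
  -- the unit root and the constant term `g(0)`
  obtain ⟨-, hunit⟩ := unitRoot_spec_holds V p hord
  obtain ⟨ua, hua⟩ := hunit
  have haU : a = ((ua : ℤ_[p]) : ℚ_[p]) := by rw [ha, hua]
  have ha0 : a ≠ 0 := by rw [haU]; exact coe_units_ne_zero p ua
  have hL0 : PowerSeries.constantCoeff (padicLFunction f a) = (1 - a⁻¹) ^ 2 * (sV : ℚ_[p]) := by
    rw [ha]
    exact constantCoeff_padicLFunction_unitRoot hord hf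
  have hg0 : ((PowerSeries.constantCoeff g : ℤ_[p]) : ℚ_[p]) =
      ((u : ℤ_[p]) : ℚ_[p]) * (ϖ : ℚ_[p]) ^ (p / 2) * (ϖ' : ℚ_[p]) ^ (p / 2) *
        ((1 - a⁻¹) ^ 2 * ((sV : ℚ) : ℚ_[p])) * (a⁻¹ * ((S : ℚ) : ℚ_[p])) * o := by
    rw [← constantCoeff_iwasawaToPowerSeries p g, hιg', hprod, hB0]
    simp only [map_mul, map_prod, PowerSeries.constantCoeff_C, hL0, hBmid']
    rw [← ho]
    ring
  -- `g(0) = h(0) · fE(0)`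
  have hg0' : (PowerSeries.constantCoeff g : ℤ_[p]) =
      PowerSeries.constantCoeff h * PowerSeries.constantCoeff fE := by
    rw [← hgh, map_mul]
  -- the anomalous factor: `1 - a⁻¹ = u₂ · #Ṽ(𝔽_p) = u₂ u₃ · #Ṽ(𝔽_p)[p^∞]`
  obtain ⟨u₂, hu₂⟩ := exists_unit_one_sub_unitRoot_inv p V hord
  obtain ⟨u₃, hu₃⟩ := exists_unit_natCard_eq_mul_card_primaryComponent
    ((integralModelInt V).map (Int.castRingHom (ZMod p))).toAffine.Point p
  set Np : ℚ_[p] := (Nat.card (AddCommGroup.primaryComponent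
    ((integralModelInt V).map (Int.castRingHom (ZMod p))).toAffine.Point p) : ℚ_[p]) with hNp
  have hNcount : (V.reductionPointCount p : ℚ_[p]) = ((u₃ : ℤ_[p]) : ℚ_[p]) * Np := by
    rw [WeierstrassCurve.reductionPointCount, hNp]
    exact hu₃
  have hNp0 : Np ≠ 0 := by
    rw [hNp]
    exact_mod_cast Nat.card_pos.ne'
  have h1 : (1 - a⁻¹) = ((u₂ : ℤ_[p]) : ℚ_[p]) * ((u₃ : ℤ_[p]) : ℚ_[p]) * Np := by
    rw [ha, hu₂, hNcount, mul_assoc]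
  -- non-vanishing of `g(0)`, `fE(0)`, `h(0)`
  have hsVQ : ((sV : ℚ) : ℚ_[p]) ≠ 0 := by exact_mod_cast hsV0
  have hSQ : ((S : ℚ) : ℚ_[p]) ≠ 0 := by exact_mod_cast hS0
  have hϖQ : ((ϖ : ℚ) : ℚ_[p]) ≠ 0 := by exact_mod_cast hϖ0
  have hϖ'Q : ((ϖ' : ℚ) : ℚ_[p]) ≠ 0 := by exact_mod_cast hϖ'0
  have hu23 : ((u₂ : ℤ_[p]) : ℚ_[p]) * ((u₃ : ℤ_[p]) : ℚ_[p]) ≠ 0 :=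
    mul_ne_zero (coe_units_ne_zero p u₂) (coe_units_ne_zero p u₃)
  set U : ℚ_[p] := ((u : ℤ_[p]) : ℚ_[p]) * (ϖ : ℚ_[p]) ^ (p / 2) * (ϖ' : ℚ_[p]) ^ (p / 2) *
    (((u₂ : ℤ_[p]) : ℚ_[p]) * ((u₃ : ℤ_[p]) : ℚ_[p])) ^ 2 * a⁻¹ with hU
  have hU0 : U ≠ 0 := by
    rw [hU]
    exact mul_ne_zero (mul_ne_zero (mul_ne_zero (mul_ne_zero (coe_units_ne_zero p u)
      (pow_ne_zero _ hϖQ)) (pow_ne_zero _ hϖ'Q)) (pow_ne_zero 2 hu23)) (inv_ne_zero ha0)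
  have hg0U : ((PowerSeries.constantCoeff g : ℤ_[p]) : ℚ_[p]) =
      U * Np ^ 2 * ((sV : ℚ) : ℚ_[p]) * ((S : ℚ) : ℚ_[p]) * o := by
    rw [hg0, h1, hU]
    ring
  have hg0ne : PowerSeries.constantCoeff g ≠ 0 := by
    intro h0'
    have h' : U * Np ^ 2 * ((sV : ℚ) : ℚ_[p]) * ((S : ℚ) : ℚ_[p]) * o = 0 := by
      rw [← hg0U, h0', PadicInt.coe_zero]
    exact mul_ne_zero (mul_ne_zero (mul_ne_zero (mul_ne_zero hU0 (pow_ne_zero 2 hNp0)) hsVQ) hSQ)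
      hO' h'
  have hfE0 : PowerSeries.constantCoeff fE ≠ 0 := by
    intro h0'
    apply hg0ne
    rw [hg0', h0', mul_zero]
  set h0 : ℚ_[p] := ((PowerSeries.constantCoeff h : ℤ_[p]) : ℚ_[p]) with hh0
  have hh0ne : h0 ≠ 0 := by
    rw [hh0]
    intro h0'
    apply hg0ne
    rw [hg0', (PadicInt.coe_eq_zero.mp h0'), zero_mul]
  have hh0val : 0 ≤ h0.valuation := by
    rw [hh0]
    exact PadicInt.valuation_coe_nonneg
  -- CONTROL: `fE(0) ≠ 0 ⇒ Sel_{p^∞}(V_F/F)` finite, hence `V(F)` finite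
  have hSelfin : Finite (VF.selmerGroupPInfty p) :=
    SelmerControl.finite_selmerGroupPInfty_of_constantCoeff_ne_zero VF hγ D hX hchar' hfE0
  haveI hEF : Finite VF.toAffine.Point := ((VF.finite_selmerGroupPInfty_iff p).mp hSelfin).1
  haveI : Finite (VF.selmerGroupPInfty p) := hSelfin
  -- GREENBERG over `F`
  obtain ⟨u₁, hu₁⟩ := hGrF κ γ hκ hγ D hX fE hchar' hSelfin
  -- RESTRICTION `ℚ → F`: `ord_p #Ш(V) + ord_p #Ш(W) ≤ ord_p #Sel(V_F)`
  have hR := padicValNat_shaOrder_add_le_selmer_cyclotomicPrime p F V W hp2 C hC hfinV hfinW hSelfin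
  -- names
  set TF : ℚ_[p] := (Nat.card (AddCommGroup.primaryComponent VF.toAffine.Point p) : ℚ_[p]) with hTF
  set SelF : ℚ_[p] := (Nat.card (VF.selmerGroupPInfty p) : ℚ_[p]) with hSelF
  set vF : ℕ := padicValNat p VF.tamagawaProduct with hvF
  have hTF0 : TF ≠ 0 := by rw [hTF]; exact_mod_cast Nat.card_pos.ne'
  have hSelF0 : SelF ≠ 0 := by rw [hSelF]; exact_mod_cast Nat.card_pos.ne'
  have hp0 : (p : ℚ_[p]) ≠ 0 := by exact_mod_cast hp.out.ne_zero
  -- KEY identity in `ℚ_p`: `(s_V · S · o · T_F²) · U = h(0) · (u₁ · (p^{v_F} · #Sel_F))`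
  have key : (((sV : ℚ) : ℚ_[p]) * ((S : ℚ) : ℚ_[p]) * o * TF ^ 2) * U =
      h0 * (((u₁ : ℤ_[p]) : ℚ_[p]) * ((p : ℚ_[p]) ^ vF * SelF)) := by
    apply mul_right_cancel₀ (pow_ne_zero 2 hNp0)
    have hg0Q : ((PowerSeries.constantCoeff g : ℤ_[p]) : ℚ_[p]) =
        h0 * ((PowerSeries.constantCoeff fE : ℤ_[p]) : ℚ_[p]) := by
      rw [hg0', hh0]; push_cast; ring
    calc (((sV : ℚ) : ℚ_[p]) * ((S : ℚ) : ℚ_[p]) * o * TF ^ 2) * U * Np ^ 2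
        = (U * Np ^ 2 * ((sV : ℚ) : ℚ_[p]) * ((S : ℚ) : ℚ_[p]) * o) * TF ^ 2 := by ring
      _ = (h0 * ((PowerSeries.constantCoeff fE : ℤ_[p]) : ℚ_[p])) * TF ^ 2 := by rw [← hg0U, hg0Q]
      _ = h0 * (((PowerSeries.constantCoeff fE : ℤ_[p]) : ℚ_[p]) * TF ^ 2) := by ring
      _ = h0 * (((u₁ : ℤ_[p]) : ℚ_[p]) * (p : ℚ_[p]) ^ vF * Np ^ 2 * SelF) := by rw [hu₁]
      _ = h0 * (((u₁ : ℤ_[p]) : ℚ_[p]) * ((p : ℚ_[p]) ^ vF * SelF)) * Np ^ 2 := by ring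
  -- valuations of `key`
  have hva : a.valuation = 0 := by rw [haU]; exact valuation_coe_units_eq_zero p ua
  have hvU : U.valuation = ((p / 2 : ℕ) : ℤ) * (padicValRat p ϖ + padicValRat p ϖ') := by
    rw [hU, Padic.valuation_mul (mul_ne_zero (mul_ne_zero (mul_ne_zero (coe_units_ne_zero p u)
        (pow_ne_zero _ hϖQ)) (pow_ne_zero _ hϖ'Q)) (pow_ne_zero 2 hu23)) (inv_ne_zero ha0),
      Padic.valuation_mul (mul_ne_zero (mul_ne_zero (coe_units_ne_zero p u)
        (pow_ne_zero _ hϖQ)) (pow_ne_zero _ hϖ'Q)) (pow_ne_zero 2 hu23),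
      Padic.valuation_mul (mul_ne_zero (coe_units_ne_zero p u) (pow_ne_zero _ hϖQ)) (pow_ne_zero _ hϖ'Q),
      Padic.valuation_mul (coe_units_ne_zero p u) (pow_ne_zero _ hϖQ),
      Padic.valuation_pow, Padic.valuation_pow, Padic.valuation_pow,
      Padic.valuation_mul (coe_units_ne_zero p u₂) (coe_units_ne_zero p u₃),
      Padic.valuation_inv, hva, valuation_coe_units_eq_zero, valuation_coe_units_eq_zero,
      valuation_coe_units_eq_zero, Padic.valuation_ratCast, Padic.valuation_ratCast]
    ring
  have hu1S : ((u₁ : ℤ_[p]) : ℚ_[p]) * ((p : ℚ_[p]) ^ vF * SelF) ≠ 0 :=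
    mul_ne_zero (coe_units_ne_zero p u₁) (mul_ne_zero (pow_ne_zero _ hp0) hSelF0)
  have hval := congrArg Padic.valuation key
  rw [Padic.valuation_mul (mul_ne_zero (mul_ne_zero (mul_ne_zero hsVQ hSQ) hO') (pow_ne_zero 2 hTF0)) hU0,
    Padic.valuation_mul (mul_ne_zero (mul_ne_zero hsVQ hSQ) hO') (pow_ne_zero 2 hTF0),
    Padic.valuation_mul (mul_ne_zero hsVQ hSQ) hO', Padic.valuation_mul hsVQ hSQ,
    Padic.valuation_pow, Padic.valuation_ratCast, Padic.valuation_ratCast, hvU,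
    Padic.valuation_mul hh0ne hu1S, Padic.valuation_mul (coe_units_ne_zero p u₁)
      (mul_ne_zero (pow_ne_zero _ hp0) hSelF0),
    valuation_coe_units_eq_zero, Padic.valuation_mul (pow_ne_zero _ hp0) hSelF0, Padic.valuation_pow,
    Padic.valuation_p] at hval
  -- `v(T_F) = ord_p #V(F)`, `v(#Sel_F) = ord_p #Sel_{p^∞}(V_F)`
  have hvTF : TF.valuation = (padicValNat p (Nat.card VF.toAffine.Point) : ℤ) := by
    rw [hTF, Padic.valuation_natCast, padicValNat_card_addPrimaryComponent p]
  have hvSelF : SelF.valuation = (padicValNat p (Nat.card (VF.selmerGroupPInfty p)) : ℤ) := by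
    rw [hSelF, Padic.valuation_natCast]
  rw [hvTF, hvSelF] at hval
  -- `v(s_V) = v(t_V) − v(ϖ)`, `v(S) = v(t_W) − v(ϖ_mid)`
  have hvsV : padicValRat p sV = padicValRat p tV - padicValRat p ϖ := by
    rw [htV, padicValRat.mul hϖ0 hsV0]; ring
  have hvS : padicValRat p S = padicValRat p tW - padicValRat p ϖm := by rw [hvtW]; ring
  -- the restriction inequality, cast to `ℤ`
  have hR' : (padicValNat p V.shaOrder : ℤ) + padicValNat p W.shaOrder ≤
      (padicValNat p (Nat.card (VF.selmerGroupPInfty p)) : ℤ) := by exact_mod_cast hR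
  -- conclusion
  have hSV0 : (V.shaOrder : ℚ) ≠ 0 := by exact_mod_cast (V.shaOrder_pos hfinV).ne'
  have hSW0 : (W.shaOrder : ℚ) ≠ 0 := by exact_mod_cast (W.shaOrder_pos hfinW).ne'
  have hcV0 : (V.tamagawaProduct : ℚ) ≠ 0 := by exact_mod_cast V.tamagawaProduct_pos_holds.ne'
  have hcW0 : (W.tamagawaProduct : ℚ) ≠ 0 := by exact_mod_cast W.tamagawaProduct_pos_holds.ne'
  have hNV0 : ((Nat.card V.toAffine.Point : ℕ) : ℚ) ≠ 0 := by exact_mod_cast Nat.card_pos.ne'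
  have hNW0 : ((Nat.card W.toAffine.Point : ℕ) : ℚ) ≠ 0 := by exact_mod_cast Nat.card_pos.ne'
  refine ⟨tV * (Nat.card V.toAffine.Point : ℚ) ^ 2 / (V.tamagawaProduct : ℚ),
    tW * (Nat.card W.toAffine.Point : ℚ) ^ 2 / (W.tamagawaProduct : ℚ), hshaV, hshaW, ?_⟩
  rw [padicValRat.div (mul_ne_zero htV0 (pow_ne_zero 2 hNV0)) hcV0,
    padicValRat.mul htV0 (pow_ne_zero 2 hNV0), padicValRat.pow, padicValRat.of_nat, padicValRat.of_nat,
    padicValRat.div (mul_ne_zero htW0 (pow_ne_zero 2 hNW0)) hcW0,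
    padicValRat.mul htW0 (pow_ne_zero 2 hNW0), padicValRat.pow, padicValRat.of_nat, padicValRat.of_nat,
    ← hvϖm]
  push_cast at hval hR' ⊢
  linarith

end Core

end Summit.BirchSwinnertonDyer.Rank1Residual.Additive

end
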